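import Summits.CriticalPhenomena.PercolationContinuityZ3.Theorems.Transplant.FKConnectivityAllQApexHubCyl
import Summits.CriticalPhenomena.PercolationContinuityZ3.Theorems.Transplant.FKConnectivityAllQK4
import HarnessLib

/-!
# Connectivity correlation inequalities for `φ_{w,q}`, every `q > 0` — the HUB INEQUALITY AT AN APEX, file 2:
# Ayyer–Linusson–Ravichandran's (13)/(14) at the triples `(u; x; v)` and `(v; u; x)` for an apex `x` over `(u, v)` in an
# ARBITRARY weighted graph, EVERY `q > 0`

Support file (`--supports stmt-CriticalPhenomena-4575`), census seat `prim-bschramm-census` (gen 22) of the post-continuity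
programme; builds on p205010 (kernel theorem, internal audit signed; external expert review pending).  No definitions, no named
facts, no sorries; standard axioms.  Continues `…ApexHubCyl.lean` (leaf-type cylinders of an apex, the table lemma).

* **`hubUnder_apex_series`** (`(o,a,b) = (u,x,v)`): `φ(u ↔ x)·φ(v ↔ x) ≤ φ(u ↔ x ↔ v)` — the two halves of a series pair through an
  apex `x` over `(u,v)` are positively correlated, for EVERY `q > 0` and every surrounding weighted graph;
* **`hubUnder_apex_hub`**, `hubUnder_apex_hub'` (`(o,a,b) = (v,u,x)`, `(x,u,v)`): `φ(v ↔ u)·φ(x ↔ u) ≤ φ(v ↔ u ↔ x)`, every `q > 0`.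
Both are instances of ALR's printed open inequality (13) (strong form (14)) for `φ_{w,q}`, `q < 1`, not covered by the tree's
series–parallel theorems (`hubUnder_of_isTTSP_mem` needs the whole support series–parallel; here only the apex is constrained, the
rest of the graph is arbitrary).  By the table lemma each of `Z, S(A), S(B), S(A ∩ B)` is an explicit combination of the leaf-type
weights `N = (1−a)(1−b)`, `U = a(1−b)r`, `V' = (1−a)br`, `W = abr` (`a = w(ux)`, `b = w(xv)`, `r = q⁻¹`) and the two base masses
`A₀ = S°(K')`, `B₀ = S°(K'ᶜ)`; the defects are `A₀²·N(U+V'+W) + A₀B₀·N(U+V'+W+Wr)` and `B₀²·Wr(N+V') + A₀B₀·(NV'+NW+UV'+V'²+V'W)`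
(census seat gen 22, exact computer algebra `code/apexhub_uvw.py`; here `ring` + `positivity`).  Files 3–4 treat two and three
apex terminals (`0 < q ≤ 1`), giving the hub inequality at EVERY triple of every weighted double cone `K_{2,m}`, `K_{1,1,m}`.
[cite: AyyerLinussonRavichandran2025, §7 eq. (13)–(15), Conj. 7.1 (p. 22)] [cite: Grimmett2006, Thm. (3.1)(a) (p. 37); §1.4 eq. (1.20) (p. 15); §3.9 (p. 63); Thm. (3.8)]
-/

noncomputable section

namespace Summit.CriticalPhenomena.PercolationContinuityZ3.Theorems

namespace FK

open MeasureTheory Set Literature.Probability.LatticeModels Literature.Probability.Percolation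
open Literature.Probability.Percolation.DecisionTree (ind ind_of_mem ind_of_not_mem ind_nonneg)
open Literature.Probability.Percolation.TwoAvoidanceSets (ind_mul_ind)
open scoped Classical symmDiff

variable {V : Type*} [Fintype V]

/-! ### The hub inequality at the triples `(u; x; v)` and `(v; u; x)` -/

/-- Pure algebra for `hubUnder_apex_series`: with `N = (1−a)(1−b)`, `U = a(1−b)r`, `V' = (1−a)br`, `W = abr`,
`Z·S(A∩B) − S(A)S(B) = A₀²·N(U+V'+W) + A₀B₀·N(U+V'+W+Wr) ≥ 0`. [cite: AyyerLinussonRavichandran2025, §7 eq. (13) (p. 22)] -/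
theorem apex_series_alg {a b r A₀ B₀ SA SB SAB Z : ℝ} (ha0 : 0 ≤ a) (ha1 : 0 ≤ 1 - a) (hb0 : 0 ≤ b) (hb1 : 0 ≤ 1 - b)
    (hr : 0 ≤ r) (hA : 0 ≤ A₀) (hB : 0 ≤ B₀)
    (hSA : SA = a * b * r * ((A₀ + B₀) + (r - 1) * B₀) + a * (1 - b) * r * (A₀ + B₀) + (1 - a) * b * r * A₀ + (1 - a) * (1 - b) * 0)
    (hSB : SB = a * b * r * ((A₀ + B₀) + (r - 1) * B₀) + a * (1 - b) * r * A₀ + (1 - a) * b * r * (A₀ + B₀) + (1 - a) * (1 - b) * 0)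
    (hSAB : SAB = a * b * r * ((A₀ + B₀) + (r - 1) * B₀) + a * (1 - b) * r * A₀ + (1 - a) * b * r * A₀ + (1 - a) * (1 - b) * 0)
    (hZ : Z = a * b * r * ((A₀ + B₀) + (r - 1) * B₀) + a * (1 - b) * r * (A₀ + B₀) + (1 - a) * b * r * (A₀ + B₀) +
      (1 - a) * (1 - b) * (A₀ + B₀)) :
    SA * SB ≤ Z * SAB := by
  rw [← sub_nonneg]
  have key : Z * SAB - SA * SB =
      A₀ ^ 2 * ((1 - a) * (1 - b) * (a * (1 - b) * r + (1 - a) * b * r + a * b * r)) +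
        A₀ * B₀ * ((1 - a) * (1 - b) * (a * (1 - b) * r + (1 - a) * b * r + a * b * r + a * b * r * r)) := by
    rw [hSA, hSB, hSAB, hZ]; ring
  rw [key]
  positivity

/-- Pure algebra for `hubUnder_apex_hub`: `Z·S(A∩B) − S(A)S(B) = B₀²·Wr(N+V') + A₀B₀·(NV' + NW + UV' + V'² + V'W) ≥ 0`.
[cite: AyyerLinussonRavichandran2025, §7 eq. (13) (p. 22)] -/
theorem apex_hub_alg {a b r A₀ B₀ SA SB SAB Z : ℝ} (ha0 : 0 ≤ a) (ha1 : 0 ≤ 1 - a) (hb0 : 0 ≤ b) (hb1 : 0 ≤ 1 - b)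
    (hr : 0 ≤ r) (hA : 0 ≤ A₀) (hB : 0 ≤ B₀)
    (hSA : SA = a * b * r * ((A₀ + B₀) + (r - 1) * B₀) + a * (1 - b) * r * A₀ + (1 - a) * b * r * A₀ + (1 - a) * (1 - b) * A₀)
    (hSB : SB = a * b * r * ((A₀ + B₀) + (r - 1) * B₀) + a * (1 - b) * r * (A₀ + B₀) + (1 - a) * b * r * A₀ + (1 - a) * (1 - b) * 0)
    (hSAB : SAB = a * b * r * ((A₀ + B₀) + (r - 1) * B₀) + a * (1 - b) * r * A₀ + (1 - a) * b * r * A₀ + (1 - a) * (1 - b) * 0)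
    (hZ : Z = a * b * r * ((A₀ + B₀) + (r - 1) * B₀) + a * (1 - b) * r * (A₀ + B₀) + (1 - a) * b * r * (A₀ + B₀) +
      (1 - a) * (1 - b) * (A₀ + B₀)) :
    SA * SB ≤ Z * SAB := by
  rw [← sub_nonneg]
  have key : Z * SAB - SA * SB =
      B₀ ^ 2 * (a * b * r * r * ((1 - a) * (1 - b) + (1 - a) * b * r)) +
        A₀ * B₀ * ((1 - a) * (1 - b) * ((1 - a) * b * r) + (1 - a) * (1 - b) * (a * b * r) +
          (a * (1 - b) * r) * ((1 - a) * b * r) + ((1 - a) * b * r) ^ 2 + ((1 - a) * b * r) * (a * b * r)) := by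
    rw [hSA, hSB, hSAB, hZ]; ring
  rw [key]
  positivity


/-- **The hub inequality at `(u; x; v)` for an apex `x` over `(u, v)` — EVERY `q > 0`, any surrounding weighted graph**:
`φ_{w,q}(u ↔ x)·φ_{w,q}(v ↔ x) ≤ φ_{w,q}(u ↔ x ↔ v)`, i.e. the two halves of a series pair are positively correlated
(Ayyer–Linusson–Ravichandran's (13), strong form (14), at the middle vertex of a series pair; for `q ≥ 1` this is FKG, for `q < 1`
no FKG is available). [cite: AyyerLinussonRavichandran2025, §7 eq. (13)–(14) (p. 22)] [cite: Grimmett2006, §3.9 (p. 63); Thm. (3.8)] -/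
theorem hubUnder_apex_series (w : Sym2 V → unitInterval) {q : ℝ} (hq : 0 < q) {u v x : V} (hxu : x ≠ u) (hxv : x ≠ v)
    (huv : u ≠ v) (hw : ∀ e : Sym2 V, x ∈ e → ((w e : unitInterval) : ℝ) ≠ 0 → u ∈ e ∨ v ∈ e) :
    HubUnder (rcMeasureW w q ∅) u x v := by
  have hq0 : q ≠ 0 := hq.ne'
  set K : Set (BondConfig V) := {ω : BondConfig V | ω \ {s(u, x), s(x, v)} ∈ (openConn u v : Set (BondConfig V))} with hK
  -- insensitivity of the auxiliary events
  have hKa : ∀ ω : BondConfig V, ω ∆ {s(u, x)} ∈ K ↔ ω ∈ K := apexAvoid_insens u v x (Or.inl rfl)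
  have hKb : ∀ ω : BondConfig V, ω ∆ {s(x, v)} ∈ K ↔ ω ∈ K := apexAvoid_insens u v x (Or.inr rfl)
  have hUa : ∀ ω : BondConfig V, ω ∆ {s(u, x)} ∈ (Set.univ : Set (BondConfig V)) ↔ ω ∈ (Set.univ : Set (BondConfig V)) :=
    fun ω => by simp only [Set.mem_univ]
  have hUb : ∀ ω : BondConfig V, ω ∆ {s(x, v)} ∈ (Set.univ : Set (BondConfig V)) ↔ ω ∈ (Set.univ : Set (BondConfig V)) :=
    fun ω => by simp only [Set.mem_univ]
  -- almost surely the open pairs at `x` lie in `{ux, xv}`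
  have hapex : ∀ ω, rcWeightW w q ∅ ω ≠ 0 → ∀ e ∈ ω, x ∈ e → e = s(u, x) ∨ e = s(x, v) :=
    fun ω hω => apex_of_rcWeightW_ne_zero w q hxu hxv hw hω
  have hadj_u : ∀ ω : BondConfig V, s(u, x) ∈ ω → ω ∈ (openConn u x : Set (BondConfig V)) := fun ω ha =>
    (mem_openConn_iff' u x ω).2 ((openGraph_adj ω u x).2 ⟨ha, hxu.symm⟩).reachable
  have hadj_v : ∀ ω : BondConfig V, s(x, v) ∈ ω → ω ∈ (openConn v x : Set (BondConfig V)) := fun ω hb =>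
    (mem_openConn_iff' v x ω).2 ((openGraph_adj ω v x).2 ⟨by rw [Sym2.eq_swap]; exact hb, hxv.symm⟩).reachable
  have hKiff : ∀ ω : BondConfig V, ω ∈ K ↔ (openGraph (ω \ {s(u, x), s(x, v)})).Reachable u v := fun ω => by
    rw [hK, Set.mem_setOf_eq, mem_openConn_iff']
  -- the three tables
  have hA := apex_mass_table w hq0 hxu hxv huv hw (openConn u x) Set.univ Set.univ K ∅
    (fun ω _ ha _ => iff_of_true (hadj_u ω ha) (Set.mem_univ _))
    (fun ω _ _ ha => iff_of_true (hadj_u ω ha) (Set.mem_univ _))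
    (fun ω hω ha hb => by
      rw [mem_openConn_iff', reachable_ux_apex_iff hxu hxv (hapex ω hω), hKiff]
      exact ⟨fun h => h.elim (fun h' => absurd h' ha) fun h' => h'.2, fun h => Or.inr ⟨hb, h⟩⟩)
    (fun ω hω ha hb => by
      rw [mem_openConn_iff', reachable_ux_apex_iff hxu hxv (hapex ω hω)]
      exact ⟨fun h => h.elim (fun h' => absurd h' ha) fun h' => absurd h'.1 hb, fun h => absurd h (Set.notMem_empty ω)⟩)
    hUa hUb hUa hKb
  have hB := apex_mass_table w hq0 hxu hxv huv hw (openConn v x) Set.univ K Set.univ ∅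
    (fun ω _ _ hb => iff_of_true (hadj_v ω hb) (Set.mem_univ _))
    (fun ω hω hb ha => by
      rw [mem_openConn_iff', reachable_vx_apex_iff hxu hxv (hapex ω hω), hKiff]
      exact ⟨fun h => h.elim (fun h' => absurd h' hb) fun h' => h'.2, fun h => Or.inr ⟨ha, h⟩⟩)
    (fun ω _ _ hb => iff_of_true (hadj_v ω hb) (Set.mem_univ _))
    (fun ω hω ha hb => by
      rw [mem_openConn_iff', reachable_vx_apex_iff hxu hxv (hapex ω hω)]
      exact ⟨fun h => h.elim (fun h' => absurd h' hb) fun h' => absurd h'.1 ha, fun h => absurd h (Set.notMem_empty ω)⟩)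
    hUa hUb hKa hUb
  have hAB := apex_mass_table w hq0 hxu hxv huv hw (openConn u x ∩ openConn v x) Set.univ K K ∅
    (fun ω _ ha hb => iff_of_true ⟨hadj_u ω ha, hadj_v ω hb⟩ (Set.mem_univ _))
    (fun ω hω hb ha => by
      rw [Set.mem_inter_iff, mem_openConn_iff' v x, reachable_vx_apex_iff hxu hxv (hapex ω hω), hKiff]
      exact ⟨fun h => h.2.elim (fun h' => absurd h' hb) fun h' => h'.2, fun h => ⟨hadj_u ω ha, Or.inr ⟨ha, h⟩⟩⟩)
    (fun ω hω ha hb => by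
      rw [Set.mem_inter_iff, mem_openConn_iff' u x, reachable_ux_apex_iff hxu hxv (hapex ω hω), hKiff]
      exact ⟨fun h => h.1.elim (fun h' => absurd h' ha) fun h' => h'.2, fun h => ⟨Or.inr ⟨hb, h⟩, hadj_v ω hb⟩⟩)
    (fun ω hω ha hb => by
      rw [Set.mem_inter_iff, mem_openConn_iff' u x, reachable_ux_apex_iff hxu hxv (hapex ω hω)]
      exact ⟨fun h => h.1.elim (fun h' => absurd h' ha) fun h' => absurd h'.1 hb, fun h => absurd h (Set.notMem_empty ω)⟩)
    hUa hUb hKa hKb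
  have hZ := apex_mass_table w hq0 hxu hxv huv hw Set.univ Set.univ Set.univ Set.univ Set.univ
    (fun _ _ _ _ => Iff.rfl) (fun _ _ _ _ => Iff.rfl) (fun _ _ _ _ => Iff.rfl) (fun _ _ _ _ => Iff.rfl) hUa hUb hUa hUb
  -- the base masses
  rw [← hK] at hA hB hAB hZ
  set w0 := Function.update (Function.update w s(u, x) 0) s(x, v) 0 with hw0
  have hsplit := sum_rcWeightW_ind_univ_eq_add w0 q K
  have hE : ∑ ω : BondConfig V, rcWeightW w0 q ∅ ω * ind (∅ : Set (BondConfig V)) ω = 0 := sum_rcWeightW_ind_empty w0 q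
  have hA0 := sum_rcWeightW_ind_nonneg w0 hq.le K
  have hB0 := sum_rcWeightW_ind_nonneg w0 hq.le Kᶜ
  have ha0 : 0 ≤ ((w s(u, x) : unitInterval) : ℝ) := (w s(u, x)).2.1
  have ha1 : 0 ≤ 1 - ((w s(u, x) : unitInterval) : ℝ) := sub_nonneg.2 (w s(u, x)).2.2
  have hb0 : 0 ≤ ((w s(x, v) : unitInterval) : ℝ) := (w s(x, v)).2.1
  have hb1 : 0 ≤ 1 - ((w s(x, v) : unitInterval) : ℝ) := sub_nonneg.2 (w s(x, v)).2.2
  have hr : 0 ≤ q⁻¹ := inv_nonneg.2 hq.le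
  -- assemble
  unfold HubUnder
  apply real_mul_le_of_mass w hq
  rw [← sum_rcWeightW_ind_univ w q]
  exact apex_series_alg ha0 ha1 hb0 hb1 hr hA0 hB0 (hA.trans (by rw [hsplit, Set.univ_inter, hE]))
    (hB.trans (by rw [hsplit, Set.univ_inter, hE])) (hAB.trans (by rw [hsplit, Set.univ_inter, hE]))
    (hZ.trans (by rw [hsplit, Set.univ_inter]))

/-- **The hub inequality at `(v; u; x)` for an apex `x` over `(u, v)` — EVERY `q > 0`, any surrounding weighted graph**:
`φ_{w,q}(v ↔ u)·φ_{w,q}(x ↔ u) ≤ φ_{w,q}(v ↔ u ↔ x)` (ALR (13)/(14) with the hub at `u` and one leg the apex).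
[cite: AyyerLinussonRavichandran2025, §7 eq. (13)–(14) (p. 22)] [cite: Grimmett2006, §3.9 (p. 63); Thm. (3.8)] -/
theorem hubUnder_apex_hub (w : Sym2 V → unitInterval) {q : ℝ} (hq : 0 < q) {u v x : V} (hxu : x ≠ u) (hxv : x ≠ v)
    (huv : u ≠ v) (hw : ∀ e : Sym2 V, x ∈ e → ((w e : unitInterval) : ℝ) ≠ 0 → u ∈ e ∨ v ∈ e) :
    HubUnder (rcMeasureW w q ∅) v u x := by
  have hq0 : q ≠ 0 := hq.ne'
  set K : Set (BondConfig V) := {ω : BondConfig V | ω \ {s(u, x), s(x, v)} ∈ (openConn u v : Set (BondConfig V))} with hK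
  have hKa : ∀ ω : BondConfig V, ω ∆ {s(u, x)} ∈ K ↔ ω ∈ K := apexAvoid_insens u v x (Or.inl rfl)
  have hKb : ∀ ω : BondConfig V, ω ∆ {s(x, v)} ∈ K ↔ ω ∈ K := apexAvoid_insens u v x (Or.inr rfl)
  have hUa : ∀ ω : BondConfig V, ω ∆ {s(u, x)} ∈ (Set.univ : Set (BondConfig V)) ↔ ω ∈ (Set.univ : Set (BondConfig V)) :=
    fun ω => by simp only [Set.mem_univ]
  have hUb : ∀ ω : BondConfig V, ω ∆ {s(x, v)} ∈ (Set.univ : Set (BondConfig V)) ↔ ω ∈ (Set.univ : Set (BondConfig V)) :=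
    fun ω => by simp only [Set.mem_univ]
  have hapex : ∀ ω, rcWeightW w q ∅ ω ≠ 0 → ∀ e ∈ ω, x ∈ e → e = s(u, x) ∨ e = s(x, v) :=
    fun ω hω => apex_of_rcWeightW_ne_zero w q hxu hxv hw hω
  have hadj_u : ∀ ω : BondConfig V, s(u, x) ∈ ω → ω ∈ (openConn x u : Set (BondConfig V)) := fun ω ha =>
    (mem_openConn_iff' x u ω).2 ((openGraph_adj ω u x).2 ⟨ha, hxu.symm⟩).reachable.symm
  have hpath : ∀ ω : BondConfig V, s(u, x) ∈ ω → s(x, v) ∈ ω → ω ∈ (openConn v u : Set (BondConfig V)) := fun ω ha hb =>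
    (mem_openConn_iff' v u ω).2
      (((openGraph_adj ω v x).2 ⟨by rw [Sym2.eq_swap]; exact hb, hxv.symm⟩).reachable.trans
        ((openGraph_adj ω x u).2 ⟨by rw [Sym2.eq_swap]; exact ha, hxu⟩).reachable)
  have hKiff : ∀ ω : BondConfig V, ω ∈ K ↔ (openGraph (ω \ {s(u, x), s(x, v)})).Reachable u v := fun ω => by
    rw [hK, Set.mem_setOf_eq, mem_openConn_iff']
  have hvu : ∀ ω : BondConfig V, ω ∈ (openConn v u : Set (BondConfig V)) ↔ (openGraph ω).Reachable u v := fun ω => by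
    rw [mem_openConn_iff']; exact ⟨SimpleGraph.Reachable.symm, SimpleGraph.Reachable.symm⟩
  -- tables: `{v ↔ u}` ~ (univ, K, K, K); `{x ↔ u}` ~ (univ, univ, K, ∅); both ~ (univ, K, K, ∅)
  have hA := apex_mass_table w hq0 hxu hxv huv hw (openConn v u) Set.univ K K K
    (fun ω _ ha hb => iff_of_true (hpath ω ha hb) (Set.mem_univ _))
    (fun ω hω hb _ => by
      rw [hvu, reachable_uv_apex_iff hxu hxv (hapex ω hω), hKiff]
      exact ⟨fun h => h.elim id fun h' => absurd h'.2 hb, fun h => Or.inl h⟩)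
    (fun ω hω ha _ => by
      rw [hvu, reachable_uv_apex_iff hxu hxv (hapex ω hω), hKiff]
      exact ⟨fun h => h.elim id fun h' => absurd h'.1 ha, fun h => Or.inl h⟩)
    (fun ω hω ha _ => by
      rw [hvu, reachable_uv_apex_iff hxu hxv (hapex ω hω), hKiff]
      exact ⟨fun h => h.elim id fun h' => absurd h'.1 ha, fun h => Or.inl h⟩)
    hUa hUb hKa hKb
  have hB := apex_mass_table w hq0 hxu hxv huv hw (openConn x u) Set.univ Set.univ K ∅
    (fun ω _ ha _ => iff_of_true (hadj_u ω ha) (Set.mem_univ _))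
    (fun ω _ _ ha => iff_of_true (hadj_u ω ha) (Set.mem_univ _))
    (fun ω hω ha hb => by
      rw [openConn_comm, mem_openConn_iff', reachable_ux_apex_iff hxu hxv (hapex ω hω), hKiff]
      exact ⟨fun h => h.elim (fun h' => absurd h' ha) fun h' => h'.2, fun h => Or.inr ⟨hb, h⟩⟩)
    (fun ω hω ha hb => by
      rw [openConn_comm, mem_openConn_iff', reachable_ux_apex_iff hxu hxv (hapex ω hω)]
      exact ⟨fun h => h.elim (fun h' => absurd h' ha) fun h' => absurd h'.1 hb, fun h => absurd h (Set.notMem_empty ω)⟩)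
    hUa hUb hUa hKb
  have hAB := apex_mass_table w hq0 hxu hxv huv hw (openConn v u ∩ openConn x u) Set.univ K K ∅
    (fun ω _ ha hb => iff_of_true ⟨hpath ω ha hb, hadj_u ω ha⟩ (Set.mem_univ _))
    (fun ω hω hb ha => by
      rw [Set.mem_inter_iff, hvu, reachable_uv_apex_iff hxu hxv (hapex ω hω), hKiff]
      exact ⟨fun h => h.1.elim id fun h' => absurd h'.2 hb, fun h => ⟨Or.inl h, hadj_u ω ha⟩⟩)
    (fun ω hω ha hb => by
      rw [Set.mem_inter_iff, openConn_comm x u, mem_openConn_iff' u x, reachable_ux_apex_iff hxu hxv (hapex ω hω), hKiff]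
      constructor
      · rintro ⟨-, h⟩; exact h.elim (fun h' => absurd h' ha) fun h' => h'.2
      · intro h
        refine ⟨?_, Or.inr ⟨hb, h⟩⟩
        rw [hvu, reachable_uv_apex_iff hxu hxv (hapex ω hω)]; exact Or.inl h)
    (fun ω hω ha hb => by
      rw [Set.mem_inter_iff, openConn_comm x u, mem_openConn_iff' u x, reachable_ux_apex_iff hxu hxv (hapex ω hω)]
      exact ⟨fun h => h.2.elim (fun h' => absurd h' ha) fun h' => absurd h'.1 hb, fun h => absurd h (Set.notMem_empty ω)⟩)
    hUa hUb hKa hKb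
  have hZ := apex_mass_table w hq0 hxu hxv huv hw Set.univ Set.univ Set.univ Set.univ Set.univ
    (fun _ _ _ _ => Iff.rfl) (fun _ _ _ _ => Iff.rfl) (fun _ _ _ _ => Iff.rfl) (fun _ _ _ _ => Iff.rfl) hUa hUb hUa hUb
  rw [← hK] at hA hB hAB hZ
  set w0 := Function.update (Function.update w s(u, x) 0) s(x, v) 0 with hw0
  have hsplit := sum_rcWeightW_ind_univ_eq_add w0 q K
  have hE : ∑ ω : BondConfig V, rcWeightW w0 q ∅ ω * ind (∅ : Set (BondConfig V)) ω = 0 := sum_rcWeightW_ind_empty w0 q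
  have hA0 := sum_rcWeightW_ind_nonneg w0 hq.le K
  have hB0 := sum_rcWeightW_ind_nonneg w0 hq.le Kᶜ
  have ha0 : 0 ≤ ((w s(u, x) : unitInterval) : ℝ) := (w s(u, x)).2.1
  have ha1 : 0 ≤ 1 - ((w s(u, x) : unitInterval) : ℝ) := sub_nonneg.2 (w s(u, x)).2.2
  have hb0 : 0 ≤ ((w s(x, v) : unitInterval) : ℝ) := (w s(x, v)).2.1
  have hb1 : 0 ≤ 1 - ((w s(x, v) : unitInterval) : ℝ) := sub_nonneg.2 (w s(x, v)).2.2
  have hr : 0 ≤ q⁻¹ := inv_nonneg.2 hq.le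
  unfold HubUnder
  apply real_mul_le_of_mass w hq
  rw [← sum_rcWeightW_ind_univ w q]
  exact apex_hub_alg ha0 ha1 hb0 hb1 hr hA0 hB0 (hA.trans (by rw [hsplit, Set.univ_inter]))
    (hB.trans (by rw [hsplit, Set.univ_inter, hE])) (hAB.trans (by rw [hsplit, Set.univ_inter, hE]))
    (hZ.trans (by rw [hsplit, Set.univ_inter]))

/-- The same inequality read with the roles of `o` and `b` exchanged: `HubUnder μ x u v`. [cite: AyyerLinussonRavichandran2025, §7 eq. (13) (p. 22)] -/
theorem hubUnder_apex_hub' (w : Sym2 V → unitInterval) {q : ℝ} (hq : 0 < q) {u v x : V} (hxu : x ≠ u) (hxv : x ≠ v)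
    (huv : u ≠ v) (hw : ∀ e : Sym2 V, x ∈ e → ((w e : unitInterval) : ℝ) ≠ 0 → u ∈ e ∨ v ∈ e) :
    HubUnder (rcMeasureW w q ∅) x u v := by
  have h := hubUnder_apex_hub w hq hxu hxv huv hw
  unfold HubUnder at h ⊢
  rw [mul_comm, Set.inter_comm]
  exact h


end FK

end Summit.CriticalPhenomena.PercolationContinuityZ3.Theorems

end
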